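import Summits.CriticalPhenomena.SAWScalingLimit.Theorems.SAWDevelopingMapHexConjectureConformalPackageGrowth
import HarnessLib

/-!
# Crux `HexConjecture` (stmt-CriticalPhenomena-0808), line `root-locality-replaces-loewner`:
the SINGLE-DOMAIN conformal package with the growth of the floor-ratio profile at the root
(stub `stub_halfPlanePackageGrowth`)

Landing target:
`Summits/CriticalPhenomena/SAWScalingLimit/Theorems/SAWDevelopingMapHexConjectureHalfPlanePackageGrowth.lean`
(`--supports stmt-CriticalPhenomena-0808`; lead continuation prover-line-stmt-CriticalPhenomena-0808-c6-0).

`exists_halfPlanePackageGrowth` is the `D`-only half of the landed conformal package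
`exists_conformalPackageGrowth` (`…HexConjectureConformalPackageGrowth`): no hull subdomain `D'`, no
restriction map, no modulus function.  For a floor Dobrushin domain `(D; a, b)` flat (radius `ρ`) at both
marks and a chordal uniformizing map `φ : (ℍ; 0, ∞) → (D; a, b)` it packages
* the half-plane map `Ψ = -1/φ⁻¹ : D → ℍ` (`exists_halfPlaneMap`, with the formula clause
  `Ψ z = -(φ⁻¹ z)⁻¹`), `‖Ψ‖ → ∞` at `a`, `Ψ → 0` at `b`;
* a continuous logarithm `L` of `Ψ'` (`exists_log_deriv`) with boundary limit `Lb` at `b`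
  (`exists_tendsto_log_deriv_of_flat`, Schwarz reflection across the flat piece at `b`);
* the floor clause: for `0 < t < ρ₁` the point `a + t` is a frontier point (`mem_frontier_of_flat`),
  `≠ a`, and `L → Ls` there (`exists_tendsto_log_deriv_floorPoint`), with the boundary profile
  `G(t) = exp ((5/8) Re (Ls - Lb))`, realised as `t ↦ exp ((5/8) Re (L̄(a + t) - Lb))` with
  `L̄ = extendFrom D L` (`extendFrom_eq`), hence continuous on `(0, ρ₁)` (`continuousOn_extendFrom_floor`);
* the growth `κ t^{-5/4} ≤ G(t)`: `log κ₀ - 2 log t ≤ Re Ls` (`rootLogDerivGrowth`, the simple pole of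
  `Ψ` at the root) and `exp_growth_rpow`, with `κ = exp ((5/8)(log κ₀ - Re Lb))`.
The radius `ρ₁` is the minimum of half the geometric radius `min ρ |a - b|` and the growth radius.
-/

noncomputable section

open scoped Topology Real
open Filter Set Metric Complex Function
open Literature.Probability.RandomPlanarGeometry
open UpperHalfPlane (upperHalfPlaneSet isOpen_upperHalfPlaneSet)

namespace Summit.CriticalPhenomena.SAWScalingLimit.Theorems.HexConjecture.RootLocality

open Summit.CriticalPhenomena.SAWScalingLimit.Theorems.ObservableToSLE.FloorRatio

/-- **The single-domain conformal package, with the growth of the boundary profile at the root.**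
For a floor Dobrushin domain `D` flat at both marks and a chordal uniformizer `φ`: the half-plane map
`Ψ = -1/φ⁻¹ : D → ℍ` (`a ↦ ∞`, `b ↦ 0`), a continuous logarithm `L` of `Ψ'` with boundary limit `Lb`
at `b` and limits `Ls` at the floor points `a + t` (`0 < t < ρ₁`), the boundary profile
`G(t) = exp((5/8) Re(Ls - Lb))`, continuous on `(0, ρ₁)`, and the growth `κ t^{-5/4} ≤ G(t)`.
See the module docstring. [cite: LawlerSchrammWerner2003Restriction, §2 (2.4) p. 7 and §2 p. 9, transposed] -/
theorem exists_halfPlanePackageGrowth (D : DobrushinDomain) (ρ : ℝ)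
    (φ : ConformalEquiv upperHalfPlaneSet D.carrier) (hρ : 0 < ρ)
    (hflat0 : D.carrier ∩ ball (D.pt 0) ρ = {z : ℂ | (D.pt 0).im < z.im} ∩ ball (D.pt 0) ρ)
    (hflat1 : D.carrier ∩ ball (D.pt 1) ρ = {z : ℂ | (D.pt 1).im < z.im} ∩ ball (D.pt 1) ρ)
    (hφ : D.IsChordalUniformizing φ) :
    ∃ (Ψ : ConformalEquiv D.carrier upperHalfPlaneSet) (L : ℂ → ℂ) (Lb : ℂ) (ρ₁ : ℝ) (G : ℝ → ℝ)
      (κ : ℝ), 0 < ρ₁ ∧ ρ₁ ≤ ρ ∧ (∀ z, Ψ z = -(φ.symm z)⁻¹) ∧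
      Tendsto (fun z => ‖Ψ z‖) (𝓝[D.carrier] (D.pt 0)) atTop ∧ Ψ.HasBoundaryValue (D.pt 1) 0 ∧
      ContinuousOn L D.carrier ∧ (∀ z ∈ D.carrier, exp (L z) = deriv Ψ z) ∧
      Tendsto L (𝓝[D.carrier] (D.pt 1)) (𝓝 Lb) ∧
      (∀ t : ℝ, 0 < t → t < ρ₁ →
        (D.pt 0 + t ∈ frontier D.carrier) ∧ (D.pt 0 + (t : ℂ) ≠ D.pt 0) ∧
        ∃ Ls : ℂ, Tendsto L (𝓝[D.carrier] (D.pt 0 + t)) (𝓝 Ls) ∧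
          Real.exp ((5 / 8) * (Ls - Lb).re) = G t) ∧
      0 < κ ∧ ContinuousOn G (Set.Ioo 0 ρ₁) ∧
      (∀ t : ℝ, 0 < t → t < ρ₁ → κ * t ^ (-(5 / 4 : ℝ)) ≤ G t) := by
  -- The `D`-half of the landed proof of `exists_conformalPackageGrowth`.
  -- names
  set a₀ : ℂ := D.pt 0 with ha₀
  set b₀ : ℂ := D.pt 1 with hb₀
  have hab : a₀ ≠ b₀ := fun h => absurd (D.pt_injective h) (by decide)
  have hdab : 0 < dist a₀ b₀ := dist_pos.2 hab
  -- the half-plane map and the logarithm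
  obtain ⟨Ψ, hΨ, hΨinf, hΨb, hΨreal⟩ := exists_halfPlaneMap D φ hφ
  obtain ⟨L, hLc, hLe⟩ := exists_log_deriv D.toJordanDomain Ψ
  -- growth at the root: `log κ₀ - 2 log t ≤ Re Ls` for `0 < t < rg`
  obtain ⟨κ₀, hκ₀, rg, hrg, hgrowth⟩ := rootLogDerivGrowth D φ hφ hρ hflat0 Ψ hΨ hLe
  rw [← ha₀] at hΨinf hΨreal hgrowth
  rw [← hb₀] at hΨb
  -- `ρ₀`: half the geometric radius
  set ρ₀ : ℝ := min ρ (dist a₀ b₀) / 2 with hρ₀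
  have hρ₀pos : 0 < ρ₀ := by rw [hρ₀]; exact half_pos (lt_min hρ hdab)
  obtain ⟨hρ₀ρ, hρ₀d⟩ : 2 * ρ₀ ≤ ρ ∧ 2 * ρ₀ ≤ dist a₀ b₀ := by
    rw [hρ₀]
    refine ⟨?_, ?_⟩ <;> linarith [min_le_left ρ (dist a₀ b₀), min_le_right ρ (dist a₀ b₀)]
  have hflatD : D.carrier ∩ ball a₀ (2 * ρ₀) = {z : ℂ | a₀.im < z.im} ∩ ball a₀ (2 * ρ₀) :=
    flat_of_subset hflat0 (ball_subset_ball hρ₀ρ) rfl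
  -- the limits of `L` at the points of the punctured diameter (sibling `…RootGrowth`)
  have hLlim : ∀ t : ℝ, t ≠ 0 → |t| < 2 * ρ₀ →
      ∃ Ls : ℂ, Tendsto L (𝓝[D.carrier] (a₀ + t)) (𝓝 Ls) := fun t ht0 ht =>
    exists_tendsto_log_deriv_floorPoint Ψ hflatD hΨreal hLc hLe ht0 ht
  have hfr : ∀ t : ℝ, |t| < 2 * ρ₀ → a₀ + t ∈ frontier D.carrier := fun t ht =>
    mem_frontier_of_flat hflat0 (ht.trans_le hρ₀ρ)
  have hne_a : ∀ t : ℝ, t ≠ 0 → a₀ + (t : ℂ) ≠ a₀ := fun t ht h => ht (by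
    have := congrArg Complex.re h; simpa using this)
  -- the final radius (also below the growth radius `rg`)
  set ρ₁ : ℝ := min ρ₀ rg with hρ₁
  have hρ₁pos : 0 < ρ₁ := lt_min hρ₀pos hrg
  have hρ₁ρ₀ : ρ₁ ≤ ρ₀ := min_le_left _ _
  have hρ₁rg : ρ₁ ≤ rg := min_le_right _ _
  -- boundary limit at `b₀`
  have hne_b' : ∀ t : ℝ, |t| < ρ₀ → b₀ + (t : ℂ) ≠ a₀ := by
    intro t ht h
    have : dist a₀ b₀ = |t| := by
      rw [← h, dist_eq_norm, show b₀ + t - b₀ = (t : ℂ) by ring, norm_real, Real.norm_eq_abs]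
    linarith
  have hbvb : ∀ t : ℝ, |t| < ρ₀ → ∃ σ : ℝ, Tendsto Ψ (𝓝[D.carrier] (b₀ + t)) (𝓝 (σ : ℂ)) :=
    fun t ht => hΨreal _ (mem_frontier_of_flat hflat1 (by linarith)) (hne_b' t ht)
  obtain ⟨Lb, hLb⟩ := exists_tendsto_log_deriv_of_flat Ψ hρ₀pos
    (flat_of_subset hflat1 (ball_subset_ball (by linarith)) rfl) hbvb hLc hLe
  -- the boundary profile `G t = exp ((5/8) Re (L(a₀ + t) - Lb))`
  obtain ⟨Lx, hLx⟩ : ∃ Lx : ℝ → ℂ, ∀ t, Lx t = extendFrom D.carrier L (a₀ + t) :=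
    ⟨_, fun t => rfl⟩
  obtain ⟨G, hG⟩ : ∃ G : ℝ → ℝ, ∀ t, G t = Real.exp ((5 / 8) * (Lx t - Lb).re) :=
    ⟨_, fun t => rfl⟩
  have hLxt : ∀ t : ℝ, 0 < t → t < ρ₁ → ∃ Ls : ℂ,
      Tendsto L (𝓝[D.carrier] (a₀ + t)) (𝓝 Ls) ∧ Lx t = Ls := by
    intro t ht htρ
    have ht2 : |t| < 2 * ρ₀ := by rw [abs_of_pos ht]; linarith
    obtain ⟨Ls, hLs⟩ := hLlim t ht.ne' ht2
    exact ⟨Ls, hLs, (hLx t).trans (extendFrom_eq (frontier_subset_closure (hfr t ht2)) hLs)⟩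
  have hGc : ContinuousOn G (Ioo 0 ρ₁) := by
    have hLxc : ContinuousOn Lx (Ioo 0 ρ₁) :=
      (continuousOn_extendFrom_floor (flat_of_subset hflat0 (ball_subset_ball (by linarith)) rfl)
        fun t ht htρ => (hLxt t ht htρ).imp fun _ h => h.1).congr fun t _ => hLx t
    exact (continuousOn_const.mul (continuous_re.comp_continuousOn
      (hLxc.sub continuousOn_const))).rexp.congr fun t _ => hG t
  refine ⟨Ψ, L, Lb, ρ₁, G, Real.exp ((5 / 8) * (Real.log κ₀ - Lb.re)), hρ₁pos, by linarith, hΨ,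
    hΨinf, hΨb, hLc, hLe, hLb, ?_, Real.exp_pos _, hGc, ?_⟩
  · -- the floor points `s = a₀ + t`, `0 < t < ρ₁`
    intro t ht htρ
    have ht2 : |t| < 2 * ρ₀ := by rw [abs_of_pos ht]; linarith
    obtain ⟨Ls, hLs, hLxs⟩ := hLxt t ht htρ
    exact ⟨hfr t ht2, hne_a t ht.ne', Ls, hLs, by rw [hG, hLxs]⟩
  · -- growth `κ t^{-5/4} ≤ G t` for `0 < t < ρ₁`
    intro t ht htρ
    obtain ⟨Ls, hLs, hLxs⟩ := hLxt t ht htρ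
    rw [hG, hLxs, sub_re]
    exact exp_growth_rpow ht (hgrowth t ht (htρ.trans_le hρ₁rg) Ls hLs)

/-! ### Registered form -/

/-- **Registered sub-goal `stub_halfPlanePackageGrowth`** (crux item stmt-CriticalPhenomena-0808,
line `root-locality-replaces-loewner`, lead continuation c6): the single-domain conformal package with
the boundary profile `G` and its growth `κ t^{-5/4} ≤ G t` at the root
(`exists_halfPlanePackageGrowth`), signature fully qualified.
[cite: LawlerSchrammWerner2003Restriction, §2 (2.4) p. 7 and §2 p. 9, transposed] -/
theorem stub_halfPlanePackageGrowth : ∀ (D : Literature.Probability.RandomPlanarGeometry.DobrushinDomain) (ρ : ℝ) (φ : Literature.Probability.RandomPlanarGeometry.ConformalEquiv UpperHalfPlane.upperHalfPlaneSet D.carrier), 0 < ρ → D.carrier ∩ Metric.ball (D.pt 0) ρ = {z : ℂ | (D.pt 0).im < z.im} ∩ Metric.ball (D.pt 0) ρ → D.carrier ∩ Metric.ball (D.pt 1) ρ = {z : ℂ | (D.pt 1).im < z.im} ∩ Metric.ball (D.pt 1) ρ → D.IsChordalUniformizing φ → ∃ (Ψ : Literature.Probability.RandomPlanarGeometry.ConformalEquiv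 D.carrier UpperHalfPlane.upperHalfPlaneSet) (L : ℂ → ℂ) (Lb : ℂ) (ρ₁ : ℝ) (G : ℝ → ℝ) (κ : ℝ), 0 < ρ₁ ∧ ρ₁ ≤ ρ ∧ (∀ z, Ψ z = -(φ.symm z)⁻¹) ∧ Filter.Tendsto (fun z => ‖Ψ z‖) (nhdsWithin (D.pt 0) D.carrier) Filter.atTop ∧ Ψ.HasBoundaryValue (D.pt 1) 0 ∧ ContinuousOn L D.carrier ∧ (∀ z ∈ D.carrier, Complex.exp (L z) = deriv Ψ z) ∧ Filter.Tendsto L (nhdsWithin (D.pt 1) D.carrier) (nhds Lb) ∧ (∀ t : ℝ, 0 < t → t < ρ₁ → (D.pt 0 + t ∈ frontier D.carrier) ∧ (D.pt 0 + (t : ℂ) ≠ D.pt 0) ∧ ∃ Ls : ℂ, Filter.Tendsto L (nhdsWithin (D.pt 0 + t) D.carrier) (nhds Ls) ∧ Real.exp ((5 / 8) * (Ls - Lb).re) = G t) ∧ 0 < κ ∧ ContinuousOn G (Set.Ioo 0 ρ₁) ∧ (∀ t : ℝ, 0 < t → t < ρ₁ → κ * t ^ (-(5 / 4 : ℝ))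 ≤ G t) :=
  fun D ρ φ hρ hflat0 hflat1 hφ => exists_halfPlanePackageGrowth D ρ φ hρ hflat0 hflat1 hφ

end Summit.CriticalPhenomena.SAWScalingLimit.Theorems.HexConjecture.RootLocality

end
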